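import Summits.MatrixMultiplication.MatrixMultiplication.Theses.ObstructionDescent
import Summits.MatrixMultiplication.MatrixMultiplication.Theorems.ObstructionDescentDegreeAxisNecessary
import Summits.MatrixMultiplication.MatrixMultiplication.Theorems.ObstructionDescentDegreeSplit
import Summits.MatrixMultiplication.MatrixMultiplication.Theorems.ObstructionCalculusLocality
import Summits.MatrixMultiplication.MatrixMultiplication.Theorems.ObstructionDescentWitnessPoints
import Literature.Computability.AlgebraicComplexity.BigCwFourthOmega

set_option linter.dupNamespace false
set_option autoImplicit false

/-!
# The information axis of `ObstructionDescent` in the kernel: transports, necessity, exactness, rungs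
(decomp-mm · lens 3 · gen 26; route `route-MatrixMultiplication-ObstructionDescent`, rev 14)

The route decides `ω(ℂ) = 2` by `closes (h₁ : NoOccurrenceObstruction) (h₂ : OccurrenceLifts) (h₃ : MultiplicityDecides)`
under its ONE equivalence layer `RankEventuallyQuadratic ⟺ ω(ℂ) = 2` (item 29039; kernel
`ObstructionDescentDegreeAxisNecessary.rankEventuallyQuadratic_iff_summit`).  The DEGREE axis (`E = NoPolyDegreeObstruction`)
got its tree certificates in gen 19 (`noPolyDegreeObstruction_of_summit`).  This file lands the matching certificates of the
INFORMATION axis — the cut pieces `P_O = NoOccurrenceObstruction` (crux 29040), `L = OccurrenceLifts` (29042),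
`D = MultiplicityDecides` (29043, declared residual; split `E ∧ B`, `B = JointBlindnessDecides` 30890) and the support
`P_M = NoMultiplicityObstruction` (29041) — which until now existed only in session kernels (gen 6–8 evidence files on item 29040):

* §1 TRANSPORTS.  The items are inlined over Mathlib; their structured readings over the landed obstruction calculus
  (`Theorems/ObstructionCalculus{Action,Invariants,Slots,PadInheritance,Locality}`) are `noOccurrenceObstruction_iff`
  (`P_O ⟺ ∀ τ > 2, eventually: HWV_{Λ,d} ≤ I(GL_m³·⟨m⟩) → HWV_{Λ,d} ≤ I(GL_m³·pad_m⟨n,n,n⟩)`) and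
  `noMultiplicityObstruction_iff` (`P_M ⟺ … coMult ⟨m⟩ Λ d ≤ coMult pad_m⟨n,n,n⟩ Λ d`); the three `setOf_…_eq` are `rfl`.
* §2 NECESSITY AND EXACTNESS.  `REQ ⟹ P_M ⟹ P_O` (a rank bound puts `pad_m⟨n,n,n⟩` in `Mat_m³·⟨m⟩`, which forces
  multiplicity domination, which forces occurrence inclusion), hence `S ⟹ P_M, P_O, L, D, B`: EVERY cut piece and the
  residual are CONSEQUENCES of the summit (the NEC tags of the dossier), and the cut is EXACT:
  `summit_iff : ω(ℂ) = 2 ⟺ P_O ∧ L ∧ D` and `summit_iff_split : ω(ℂ) = 2 ⟺ P_O ∧ L ∧ E ∧ B` (through the landed glue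
  `ObstructionDescentDegreeSplit.multiplicityDecidesGlue_holds`).
* §3 RUNGS of the ladder `ω_O ≤ ω_M ≤ ω`: the `τ`-clause of `P_M` (hence of `P_O`) holds for every `τ > ω(ℂ)`, in particular
  for every `τ > 2.37295` by the tree's kernel bound `LeGall2014_cw4_omega_le`, and uniformly at the cubic scale `m ≥ n³`.

Everything is sorry-free over `ℂ`; no definition is introduced; axioms `propext`, `Classical.choice`, `Quot.sound`.  Nothing
here proves `ω = 2`: the file CREDITS NOTHING to the route's open leaves — it certifies their tags by name.
Source: gen-7 kernel `PadInheritance_g7.lean` Part 2 (sha16 `b313732f6f9f1592`, evidence #5 on item 29040), re-based on the tree.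
[cite: BurgisserIkenmeyer2011, §2 (2.2), §3.1, Prop. 3.3; Blaser2013, Def. 5.1, §5; BurgisserClausenShokrollahi1997, §15.5;
LeGall2014, Table 2]
-/

noncomputable section

open scoped BigOperators

namespace Summit.MatrixMultiplication.MatrixMultiplication.Theorems.ObstructionDescentInformationAxis

open Literature.Computability.AlgebraicComplexity (tensorRank matMulTensor unitTensor actTensor omega admissibleExponents
  admissibleExponents_bddBelow omega_two_le exists_tensorRank_matMulTensor_le_rpow
  LeGall2014_cw4_omega_le)
open Summit.MatrixMultiplication.MatrixMultiplication.Theorems.ObstructionCalculus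
open Summit.MatrixMultiplication.MatrixMultiplication.Theses.ObstructionDescent
open Summit.MatrixMultiplication.MatrixMultiplication.Theorems.ObstructionDescentDegreeAxisNecessary
  (summit_of_rankEventuallyQuadratic rankEventuallyQuadratic_of_summit noPolyDegreeObstruction_of_summit)
open Summit.MatrixMultiplication.MatrixMultiplication.Theorems.ObstructionDescentDegreeSplit (multiplicityDecidesGlue_holds)

/-! ### §1 · Transports: the inlined items in the language of the obstruction calculus -/

/-- The inlined `W = {f | …}` of the items `P_O`/`P_M` is the carrier of `hwvSpace Λ d`. [bookkeeping] -/
theorem setOf_hwv_eq {m : ℕ} (Λ : Fin 3 → Fin m → ℕ) (d : ℕ) :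
    {f : MvPolynomial (Fin m × Fin m × Fin m) ℂ | f.IsHomogeneous d ∧ ∀ A B C : Matrix (Fin m) (Fin m) ℂ,
      ((∀ i j : Fin m, j < i → A i j = 0) ∧ ∀ i : Fin m, A i i ≠ 0) →
      ((∀ i j : Fin m, j < i → B i j = 0) ∧ ∀ i : Fin m, B i i ≠ 0) →
      ((∀ i j : Fin m, j < i → C i j = 0) ∧ ∀ i : Fin m, C i i ≠ 0) → ∀ t : Fin m → Fin m → Fin m → ℂ,
      MvPolynomial.aeval (fun p : Fin m × Fin m × Fin m =>
        Literature.Computability.AlgebraicComplexity.actTensor A B C t p.1 p.2.1 p.2.2) f =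
      (∏ i, A i i ^ Λ 0 i) * (∏ i, B i i ^ Λ 1 i) * (∏ i, C i i ^ Λ 2 i) *
        MvPolynomial.aeval (fun p : Fin m × Fin m × Fin m => t p.1 p.2.1 p.2.2) f} =
      (hwvSpace Λ d : Set (MvPolynomial (Idx m) ℂ)) := rfl

/-- The inlined vanishing condition on `GL_m³·⟨m⟩` is the carrier of `orbitVanishing ⟨m⟩`. [bookkeeping] -/
theorem setOf_vanish_unit_eq (m : ℕ) :
    {f : MvPolynomial (Fin m × Fin m × Fin m) ℂ | ∀ A B C : Matrix (Fin m) (Fin m) ℂ, A.det ≠ 0 → B.det ≠ 0 →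
      C.det ≠ 0 → MvPolynomial.aeval (fun p : Fin m × Fin m × Fin m =>
        Literature.Computability.AlgebraicComplexity.actTensor A B C
          (Literature.Computability.AlgebraicComplexity.unitTensor ℂ m) p.1 p.2.1 p.2.2) f = 0} =
      (orbitVanishing (unitTensor ℂ m) : Set (MvPolynomial (Idx m) ℂ)) := rfl

/-- The inlined vanishing condition on `GL_m³·pad_m⟨n,n,n⟩` is the carrier of `orbitVanishing (padMM ℂ n m h)`. [bookkeeping] -/
theorem setOf_vanish_pad_eq (n m : ℕ) (h : n * n ≤ m) :
    {f : MvPolynomial (Fin m × Fin m × Fin m) ℂ | ∀ A B C : Matrix (Fin m) (Fin m) ℂ, A.det ≠ 0 → B.det ≠ 0 →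
      C.det ≠ 0 → MvPolynomial.aeval (fun p : Fin m × Fin m × Fin m =>
        Literature.Computability.AlgebraicComplexity.actTensor A B C ((fun a b c : Fin m =>
          ∑ r : (Fin n × Fin n) × (Fin n × Fin n) × (Fin n × Fin n),
            (if Fin.castLE h (finProdFinEquiv r.1) = a ∧ Fin.castLE h (finProdFinEquiv r.2.1) = b ∧
              Fin.castLE h (finProdFinEquiv r.2.2) = c then (1 : ℂ) else 0) *
            Literature.Computability.AlgebraicComplexity.matMulTensor ℂ n n n r.1 r.2.1 r.2.2)) p.1 p.2.1 p.2.2) f = 0} =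
      (orbitVanishing (padMM ℂ n m h) : Set (MvPolynomial (Idx m) ℂ)) := rfl

/-- **Structured reading of `P_O`** (item 29040): no occurrence obstruction above the quadratic scale — eventually in `n`,
at every scale `m ≥ n^τ`, every type all of whose weight vectors vanish on `GL_m³·⟨m⟩` has all its weight vectors vanishing
on `GL_m³·pad_m⟨n,n,n⟩`. [cite: BurgisserIkenmeyer2011, §3.1] -/
theorem noOccurrenceObstruction_iff : NoOccurrenceObstruction ↔
    ∀ τ : ℝ, 2 < τ → ∃ n₀ : ℕ, ∀ n m : ℕ, n₀ ≤ n → ∀ h : n * n ≤ m, (n : ℝ) ^ τ ≤ (m : ℝ) →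
      ∀ (Λ : Fin 3 → Fin m → ℕ) (d : ℕ), hwvSpace Λ d ≤ orbitVanishing (unitTensor ℂ m) →
        hwvSpace Λ d ≤ orbitVanishing (padMM ℂ n m h) := by
  unfold NoOccurrenceObstruction
  refine forall_congr' fun τ => forall_congr' fun _ => exists_congr fun n₀ => forall_congr' fun n =>
    forall_congr' fun m => forall_congr' fun _ => forall_congr' fun h => forall_congr' fun _ =>
    forall_congr' fun Λ => forall_congr' fun d => ⟨fun H hle f hf => ?_, fun H W hW hu f hf => ?_⟩
  · exact H _ (setOf_hwv_eq Λ d) (fun g hg => hle hg) f hf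
  · rw [setOf_hwv_eq] at hW
    subst hW
    exact H (fun g hg => hu g hg) hf

/-- **Structured reading of `P_M`** (item 29041): multiplicity domination `coMult ⟨m⟩ Λ d ≤ coMult pad_m⟨n,n,n⟩ Λ d` for every
type and degree, eventually in `n`, at every scale `m ≥ n^τ`. [cite: BurgisserIkenmeyer2011, §3.1] -/
theorem noMultiplicityObstruction_iff : NoMultiplicityObstruction ↔
    ∀ τ : ℝ, 2 < τ → ∃ n₀ : ℕ, ∀ n m : ℕ, n₀ ≤ n → ∀ h : n * n ≤ m, (n : ℝ) ^ τ ≤ (m : ℝ) →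
      ∀ (Λ : Fin 3 → Fin m → ℕ) (d : ℕ), coMult (unitTensor ℂ m) Λ d ≤ coMult (padMM ℂ n m h) Λ d := by
  unfold NoMultiplicityObstruction
  refine forall_congr' fun τ => forall_congr' fun _ => exists_congr fun n₀ => forall_congr' fun n =>
    forall_congr' fun m => forall_congr' fun _ => forall_congr' fun h => forall_congr' fun _ =>
    forall_congr' fun Λ => forall_congr' fun d => ⟨fun H => ?_, fun H W hW => ?_⟩
  · have H' := H (hwvSpace Λ d : Set (MvPolynomial (Idx m) ℂ)) (setOf_hwv_eq Λ d).symm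
    rwa [setOf_vanish_unit_eq, setOf_vanish_pad_eq, finrank_span_inter_eq_coMult,
      finrank_span_inter_eq_coMult] at H'
  · rw [setOf_hwv_eq] at hW
    subst hW
    rw [setOf_vanish_unit_eq, setOf_vanish_pad_eq, finrank_span_inter_eq_coMult,
      finrank_span_inter_eq_coMult]
    exact H

/-! ### §2 · Necessity of every piece and exactness of the cut -/

/-- A rank bound `R(⟨n,n,n⟩) ≤ m` (`n² ≤ m`) puts `pad_m⟨n,n,n⟩` into `Mat_m³·⟨m⟩`, which forces multiplicity domination
`coMult ⟨m⟩ Λ d ≤ coMult pad_m⟨n,n,n⟩ Λ d` for EVERY type and degree. [cite: BurgisserIkenmeyer2011, §2 (2.2), §3.1] -/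
theorem coMult_le_of_rank_le {n m : ℕ} (h : n * n ≤ m) (hr : tensorRank (matMulTensor ℂ n n n) ≤ m)
    (Λ : Fin 3 → Fin m → ℕ) (d : ℕ) : coMult (unitTensor ℂ m) Λ d ≤ coMult (padMM ℂ n m h) Λ d := by
  obtain ⟨A, B, C, hABC⟩ := exists_fromCols_eq_padMM (R := ℂ) h hr
  exact coMult_unitTensor_le hABC Λ d

/-- `REQ ⟹ P_M`: eventual rank bounds `R(⟨n,n,n⟩) ≤ n^τ ≤ m` give multiplicity domination at every cell.
[cite: BurgisserIkenmeyer2011, §3.1] -/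
theorem noMultiplicityObstruction_of_rankEventuallyQuadratic (h : RankEventuallyQuadratic) :
    NoMultiplicityObstruction := by
  refine noMultiplicityObstruction_iff.2 fun τ hτ => ?_
  obtain ⟨n₀, hn₀⟩ := h τ hτ
  refine ⟨n₀, fun n m hn hnm hτm Λ d => coMult_le_of_rank_le hnm ?_ Λ d⟩
  exact_mod_cast (hn₀ n hn).trans hτm

/-- `P_M ⟹ P_O`: multiplicity domination forces occurrence inclusion (dimension count inside the finite-dimensional
`HWV_{Λ,d}`: `hwvSpace_le_orbitVanishing_of_coMult_le`). [cite: BurgisserIkenmeyer2011, §3.1] -/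
theorem noOccurrenceObstruction_of_noMultiplicityObstruction (h : NoMultiplicityObstruction) :
    NoOccurrenceObstruction := by
  refine noOccurrenceObstruction_iff.2 fun τ hτ => ?_
  obtain ⟨n₀, hn₀⟩ := noMultiplicityObstruction_iff.1 h τ hτ
  exact ⟨n₀, fun n m hn hnm hτm Λ d hu =>
    hwvSpace_le_orbitVanishing_of_coMult_le (hn₀ n m hn hnm hτm Λ d) hu⟩

/-- `REQ ⟹ P_O`. [cite: BurgisserIkenmeyer2011, §3.1] -/
theorem noOccurrenceObstruction_of_rankEventuallyQuadratic (h : RankEventuallyQuadratic) :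
    NoOccurrenceObstruction :=
  noOccurrenceObstruction_of_noMultiplicityObstruction (noMultiplicityObstruction_of_rankEventuallyQuadratic h)

/-- **NEC(`P_M`)**: `ω(ℂ) = 2 ⟹ NoMultiplicityObstruction` (support item 29041). [cite: BurgisserIkenmeyer2011, §3.1] -/
theorem noMultiplicityObstruction_of_summit (hS : _root_.MatrixMultiplication) : NoMultiplicityObstruction :=
  noMultiplicityObstruction_of_rankEventuallyQuadratic (rankEventuallyQuadratic_of_summit hS)

/-- **NEC(`P_O`)**: `ω(ℂ) = 2 ⟹ NoOccurrenceObstruction` (crux 29040 is a CONSEQUENCE of the summit; its negation is an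
occurrence-obstruction proof of `ω > 2`). [cite: BurgisserIkenmeyer2011, §3.1, §5] -/
theorem noOccurrenceObstruction_of_summit (hS : _root_.MatrixMultiplication) : NoOccurrenceObstruction :=
  noOccurrenceObstruction_of_noMultiplicityObstruction (noMultiplicityObstruction_of_summit hS)

/-- **NEC(`L`)**: `ω(ℂ) = 2 ⟹ OccurrenceLifts` (crux 29042; its conclusion `P_M` holds). [this node] -/
theorem occurrenceLifts_of_summit (hS : _root_.MatrixMultiplication) : OccurrenceLifts :=
  fun _ => noMultiplicityObstruction_of_summit hS

/-- **NEC(`D`)**: `ω(ℂ) = 2 ⟹ MultiplicityDecides` (crux 29043, declared residual; its conclusion `REQ` holds). [this node] -/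
theorem multiplicityDecides_of_summit (hS : _root_.MatrixMultiplication) : MultiplicityDecides :=
  fun _ => rankEventuallyQuadratic_of_summit hS

/-- **NEC(`B`)**: `ω(ℂ) = 2 ⟹ JointBlindnessDecides` (item 30890, the joint residual of the split of `D`). [this node] -/
theorem jointBlindnessDecides_of_summit (hS : _root_.MatrixMultiplication) : JointBlindnessDecides :=
  fun _ => rankEventuallyQuadratic_of_summit hS

/-- **Exactness of the cut of record**: `ω(ℂ) = 2 ⟺ P_O ∧ L ∧ D` — the deciding theorem `closes` one way, the three
NEC certificates the other. [this node] -/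
theorem summit_iff :
    _root_.MatrixMultiplication ↔ NoOccurrenceObstruction ∧ OccurrenceLifts ∧ MultiplicityDecides :=
  ⟨fun hS => ⟨noOccurrenceObstruction_of_summit hS, occurrenceLifts_of_summit hS, multiplicityDecides_of_summit hS⟩,
    fun h => closes h.1 h.2.1 h.2.2⟩

/-- **Exactness of the split cut**: `ω(ℂ) = 2 ⟺ P_O ∧ L ∧ E ∧ B`, through the landed glue `E → B → D`
(`multiplicityDecidesGlue_holds`, item 30891). [this node] -/
theorem summit_iff_split :
    _root_.MatrixMultiplication ↔
      NoOccurrenceObstruction ∧ OccurrenceLifts ∧ NoPolyDegreeObstruction ∧ JointBlindnessDecides :=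
  ⟨fun hS => ⟨noOccurrenceObstruction_of_summit hS, occurrenceLifts_of_summit hS, noPolyDegreeObstruction_of_summit hS,
      jointBlindnessDecides_of_summit hS⟩,
    fun h => closes h.1 h.2.1 (multiplicityDecidesGlue_holds h.2.2.1 h.2.2.2)⟩

/-- The two-piece reading: `P_M` together with the residual `D` already decides. [this node] -/
theorem summit_of_noMultiplicityObstruction (hM : NoMultiplicityObstruction) (h₃ : MultiplicityDecides) :
    _root_.MatrixMultiplication :=
  summit_of_rankEventuallyQuadratic (h₃ hM)

/-- Hence `ω(ℂ) = 2 ⟺ P_M ∧ D` as well (the information axis collapses to its multiplicity form plus the residual). [this node] -/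
theorem summit_iff_mult : _root_.MatrixMultiplication ↔ NoMultiplicityObstruction ∧ MultiplicityDecides :=
  ⟨fun hS => ⟨noMultiplicityObstruction_of_summit hS, multiplicityDecides_of_summit hS⟩,
    fun h => summit_of_noMultiplicityObstruction h.1 h.2⟩

/-! ### §3 · Rungs of the ladder `ω_O ≤ ω_M ≤ ω` -/

/-- **RUNG** (kernel): the `τ`-clause of `P_M` holds for every `τ > ω(ℂ)` — the multiplicity-obstruction exponent `ω_M` is at
most `ω` (the eventual rank bound `R(⟨n,n,n⟩) ≤ n^τ` is the landed `ObstructionDescentWitnessPoints`'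
`eventually_rank_le_rpow_of_omega_lt`). [cite: BurgisserIkenmeyer2011, Prop. 3.3; BurgisserClausenShokrollahi1997, §15.5] -/
theorem noMultiplicityObstruction_clause_of_omega_lt {τ : ℝ} (hτ : omega ℂ < τ) :
    ∃ n₀ : ℕ, ∀ n m : ℕ, n₀ ≤ n → ∀ h : n * n ≤ m, (n : ℝ) ^ τ ≤ (m : ℝ) →
      ∀ (Λ : Fin 3 → Fin m → ℕ) (d : ℕ), coMult (unitTensor ℂ m) Λ d ≤ coMult (padMM ℂ n m h) Λ d := by
  obtain ⟨n₀, hn₀⟩ := eventually_rank_le_rpow_of_omega_lt hτ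
  refine ⟨n₀, fun n m hn hnm hτm Λ d => coMult_le_of_rank_le hnm ?_ Λ d⟩
  exact_mod_cast (hn₀ n hn).trans hτm

/-- **RUNG** (kernel): the `τ`-clause of `P_O` holds for every `τ > ω(ℂ)` — `ω_O ≤ ω_M ≤ ω`. [cite: BurgisserIkenmeyer2011, Prop. 3.3] -/
theorem noOccurrenceObstruction_clause_of_omega_lt {τ : ℝ} (hτ : omega ℂ < τ) :
    ∃ n₀ : ℕ, ∀ n m : ℕ, n₀ ≤ n → ∀ h : n * n ≤ m, (n : ℝ) ^ τ ≤ (m : ℝ) →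
      ∀ (Λ : Fin 3 → Fin m → ℕ) (d : ℕ), hwvSpace Λ d ≤ orbitVanishing (unitTensor ℂ m) →
        hwvSpace Λ d ≤ orbitVanishing (padMM ℂ n m h) := by
  obtain ⟨n₀, hn₀⟩ := noMultiplicityObstruction_clause_of_omega_lt hτ
  exact ⟨n₀, fun n m hn hnm hτm Λ d hu => hwvSpace_le_orbitVanishing_of_coMult_le (hn₀ n m hn hnm hτm Λ d) hu⟩

/-- **RUNG** (kernel, record): no multiplicity obstruction — hence no occurrence obstruction — above the scale `n^{2.37295}`,
by the tree's KERNEL bound `ω(ℂ) ≤ 2.37295` (`LeGall2014_cw4_omega_le`). [cite: LeGall2014, Table 2] -/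
theorem noMultiplicityObstruction_clause_above_record {τ : ℝ} (hτ : (2.37295 : ℝ) < τ) :
    ∃ n₀ : ℕ, ∀ n m : ℕ, n₀ ≤ n → ∀ h : n * n ≤ m, (n : ℝ) ^ τ ≤ (m : ℝ) →
      ∀ (Λ : Fin 3 → Fin m → ℕ) (d : ℕ), coMult (unitTensor ℂ m) Λ d ≤ coMult (padMM ℂ n m h) Λ d :=
  noMultiplicityObstruction_clause_of_omega_lt ((LeGall2014_cw4_omega_le ℂ).trans_lt hτ)

/-- **RUNG** (kernel, uniform): at the cubic scale there is no obstruction at all — for EVERY `n` and every `m ≥ n³`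
multiplicity domination holds (the standard algorithm, `R(⟨n,n,n⟩) ≤ n³`). [cite: Blaser2013, §5] -/
theorem noMultiplicityObstruction_cubic {n m : ℕ} (h : n * n ≤ m) (hm : n * n * n ≤ m)
    (Λ : Fin 3 → Fin m → ℕ) (d : ℕ) : coMult (unitTensor ℂ m) Λ d ≤ coMult (padMM ℂ n m h) Λ d :=
  coMult_le_of_rank_le h ((Literature.Computability.AlgebraicComplexity.tensorRank_matMulTensor_le ℂ n n n).trans hm) Λ d

/-- The window of the information axis: the `τ`-clauses of `P_O` and `P_M` are theorems for `τ > ω(ℂ)` and the items quantify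
over `τ > 2`, so both cruxes live exactly on `τ ∈ (2, ω(ℂ)]` — empty iff the summit holds. [this node] -/
theorem noMultiplicityObstruction_of_omega_eq_two (hω : omega ℂ = 2) : NoMultiplicityObstruction :=
  noMultiplicityObstruction_iff.2 fun _ hτ => noMultiplicityObstruction_clause_of_omega_lt (hω ▸ hτ)

end Summit.MatrixMultiplication.MatrixMultiplication.Theorems.ObstructionDescentInformationAxis

end
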